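import Literature.Probability.LatticeModels.MeanFieldAveraged
import Literature.Probability.LatticeModels.MeanFieldDifferentialInequality
import HarnessLib

/-!
# Exponential decay of the two-point function below `β_c` (crit-ising.S08) — the discharge

Topic `Probability/LatticeModels`, namespace `Literature.CritIsing`. Sibling proof file of
`Literature.Probability.LatticeModels.Sharpness`: it discharges the named fact
`Literature.Probability.LatticeModels.twoPoint_exponentialDecay_of_lt_criticalBeta` (crit-ising.S08, Aizenman–Barsky–
Fernández 1987, Thm. 1 / Duminil-Copin–Tassion 2016, Thm. 1.2: for the nearest-neighbour Ising
model on `ℤ^d`, `d ≥ 2`, and `0 ≤ β < β_c`, `⟨σ₀σ_x⟩^∅_β ≤ exp(-c_β ‖x‖)`), and Duminil-Copin–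
Tassion's eq. (2.6) (`dct_magnetization_lower_bound` of `SharpnessSubcritical`), by composing

* `dct_meanField_differentialInequality_holds` (`MeanFieldDifferentialInequality`: Lemma 2.6 with
  the 2018 correction, proved by random currents with a ghost), with
* `twoPoint_exponentialDecay_of_differentialInequality` /
  `dct_magnetization_lower_bound_of_differentialInequality` (`MeanFieldAveraged`: everything else —
  the modified Simon inequality (`ModifiedSimonInequality`), GKS, the existence of the free and
  plus states, translation covariance and the iteration (`SharpnessSubcritical`), the integration
  of the differential inequality with the averaged correcting term, `Λ ↑ ℤ^d`, `h ↘ 0`, and the GHS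
  concavity (`GHSInequality`)).

All of Duminil-Copin–Tassion's proof of the Ising half of their Theorem 1.2, item 3, is thereby
formalised; the axiom closure is the standard one.

## References

* H. Duminil-Copin, V. Tassion, Comm. Math. Phys. 343 (2016) 725–745, Thm. 1.2 / Thm. 2.1 and
  §2 (arXiv:1502.03050 numbering); Correction, Comm. Math. Phys. 359 (2018) 821–822.
* M. Aizenman, D. J. Barsky, R. Fernández, J. Stat. Phys. 47 (1987) 343–374, Thm. 1.
-/

noncomputable section

namespace Literature.Probability.LatticeModels

variable {d : ℕ}

/-- **Duminil-Copin–Tassion 2016, eq. (2.6), proved**: for the nearest-neighbour Ising model on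
`ℤ^d`, `d ≥ 1`, and `0 < β₁ ≤ β` such that `φ_{β'}(S) ≥ 1` for every `β' > β₁` and every finite
`S ∋ 0`, `m*(β) ≥ √((β² - β₁²)/β²)` — the discharge of the named fact
`dct_magnetization_lower_bound` of `SharpnessSubcritical`. [cite: DuminilCopinTassionCMP2016, §2.4, eq. (2.6) (arXiv:1502.03050 numbering), with the Correction CMP 359 (2018) 821] -/
theorem dct_magnetization_lower_bound_holds : dct_magnetization_lower_bound (d := d) :=
  dct_magnetization_lower_bound_of_differentialInequality dct_meanField_differentialInequality_holds

/-- **crit-ising.S08, proved: exponential decay of the free two-point function below `β_c`**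
(Aizenman–Barsky–Fernández 1987, Thm. 1; Duminil-Copin–Tassion 2016, Thm. 1.2 / Thm. 2.1, third
item): the discharge of the named fact `twoPoint_exponentialDecay_of_lt_criticalBeta` of
`Sharpness`. [cite: AizenmanBarskyFernandezJSP1987, Thm. 1] [cite: DuminilCopinTassionCMP2016, Thm. 1.2 (= Thm. 2.1 of arXiv:1502.03050), §2] -/
theorem twoPoint_exponentialDecay_of_lt_criticalBeta_holds :
    twoPoint_exponentialDecay_of_lt_criticalBeta (d := d) :=
  twoPoint_exponentialDecay_of_differentialInequality dct_meanField_differentialInequality_holds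

/-- **crit-ising.S08 in the language of P4, proved: below `β_c` the free two-point function
`x ↦ ⟨σ₀σ_x⟩^∅_{β,0}` has exponential decay (`HasExponentialDecay`)** — the discharge of the named
fact `hasExponentialDecay_twoPointFree_of_lt_criticalBeta` of `Sharpness`. For `d ≥ 2` and
`0 ≤ β < β_c(d)`, `twoPoint_exponentialDecay_of_lt_criticalBeta_holds` (Aizenman–Barsky–Fernández
1987, Thm. 1; Duminil-Copin–Tassion 2016, Thm. 1.2, third item) gives `c > 0` with
`⟨σ₀σ_x⟩^∅_β ≤ e^{-c‖x‖}` for all `x`, and the first Griffiths inequality in the free state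
(`twoPointFree_nonneg`, from `GKSInequalities.gks_one_holds` and `hasBoxLimit_isingCorr_free_holds`;
Friedli–Velenik 2017, Thm. 3.20, eq. (3.21)) gives `0 ≤ ⟨σ₀σ_x⟩^∅_β`, so
`|⟨σ₀σ_x⟩^∅_β| ≤ 1 · e^{-c‖x‖}`: `HasExponentialDecay` holds with `C = 1`, `m = c`. [cite: AizenmanBarskyFernandezJSP1987, Thm. 1] [cite: DuminilCopinTassionCMP2016, Thm. 1.2, third item] [cite: FriedliVelenik2017, Thm. 3.20, eq. (3.21)] -/
theorem hasExponentialDecay_twoPointFree_of_lt_criticalBeta_holds :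
    hasExponentialDecay_twoPointFree_of_lt_criticalBeta (d := d) := by
  intro hd β hβ hβc
  obtain ⟨c, hc, hcx⟩ := twoPoint_exponentialDecay_of_lt_criticalBeta_holds hd hβ hβc
  refine ⟨1, c, hc, fun x => ?_⟩
  rw [one_mul, abs_of_nonneg (twoPointFree_nonneg hasBoxLimit_isingCorr_free_holds
    (fun {Λ A β h bc} => GKSInequalities.gks_one_holds (zdGraph d)) hβ x)]
  exact hcx x

end Literature.Probability.LatticeModels
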